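import Summits.RiemannHypothesis.RiemannHypothesis.Theorems.SignConeConeMagnificationDesignDefs
import Summits.RiemannHypothesis.RiemannHypothesis.Theorems.SignConeConeMagnificationStubDeficitOfTorus

/-!
# Stub `stub_deficitOfDesign` of line `Sketch` for crux `SignCone.ConeMagnification` — spine A (file 1 of 3)
(item stmt-RiemannHypothesis-16303, route route-RiemannHypothesis-SignCone; `--supports`, registered sub-goal
`stub_deficitOfDesign_beta1`)

The regrouping and the Fejér step of the finite design spine (2001 W-MAG programme §5, Prop. 5.3), over the
vocabulary of `SignConeConeMagnificationDesignDefs`: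

* REGROUPING (eq. (marginal)/(EtA)): under AX-A the design series `Σ'_n (d(n)/n)·Φ_{S,a,φ}(n)` equals
  `Σ_{A ⊆ S} w_A · ρ_S(n_A)` (`Design.tsum_design_eq_sum_rho`): every `n` with nonzero profile factors uniquely
  as `n = n_A · k`, `A = {p ∈ S : p ∣ n}`, `k` coprime to `Π_S p` (slices `Design.slice`, reindexing `tsum_slice`);
* eq:beta1 (`Design.abs_sum_sqrt_rho_le`, registered here verbatim as `stub_deficitOfDesign_beta1`): AX-A and the
  design inequality AX-C at slack `M` give, for every finite nonempty set `S` of primes and `a : S → [0,1]`,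
  `|Σ_{p∈S} a_p √p ρ_S(p)| ≤ 2M − 4 ρ_S(1)` — regroup by `|A|` into a nonnegative cosine polynomial and apply the
  discrete Fejér step `|β₁| ≤ 2β₀` (`fejer_abs_coeff_one_le_two_mul_coeff_zero`, exact quadrature at roots of
  unity, landed in `…StubDeficitOfTorus`).

Adapted from the prior programme's kernel-checked stockroom file
`reserve/prior-2001/Prior/RiemannHypothesis/RiemannHypothesis/Rh_WMagnificationY1_MagDeficit.lean` (interface
structure replaced by explicit hypotheses; `nOf A` spelled `Π_{p∈A} p`).
-/

noncomputable section

-- `Summit.RiemannHypothesis.RiemannHypothesis.…` repeats a namespace component by design (D-0017 layout).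
set_option linter.dupNamespace false

open Finset

namespace Summit.RiemannHypothesis.RiemannHypothesis.Theorems.SignConeConeMagnification

namespace Design

-- adapted from reserve/prior-2001/Prior/RiemannHypothesis/RiemannHypothesis/Rh_WMagnificationY1_MagDeficit.lean (2001 programme)

/-! ### Regrouping the design series by `S`-smooth parts (2001 W-MAG eq. (marginal)/(EtA))

Every `n` with nonzero profile factors uniquely as `n = n_A · k` with
`A = {p ∈ S : p ∣ n}` and `k` coprime to `Π_{p∈S} p`; grouping the absolutely
convergent design series accordingly turns `Σ_n (d(n)/n)·Φ_α(t(n))` into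
`Σ_{A ⊆ S} w_A · ρ_S(n_A)` — the display `g(φ) ≥ 0` of 2001 W-MAG Prop. 5.3. -/

section Regroup

variable {c : ℕ → ℝ} {S : Finset ℕ} {a : ℕ → ℝ} {φ : ℝ}

/-- A prime dividing `Π_{p ∈ A} p` (all `p ∈ A` prime) belongs to `A` (the converse is `Finset.dvd_prod_of_mem`;
the `iff` is `Literature.NumberTheory.Sieve.PolynomialOmegaNoAtom.prime_dvd_prod_primes_iff`, not imported here to keep
the sieve library out of this file's closure). [folklore] -/
theorem mem_of_prime_dvd_prod_primes {A : Finset ℕ} (hA : ∀ p ∈ A, p.Prime) {q : ℕ} (hq : q.Prime)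
    (h : q ∣ ∏ p ∈ A, p) : q ∈ A := by
  obtain ⟨p, hp, hqp⟩ := (Prime.dvd_finsetProd_iff hq.prime id).mp h
  rwa [(Nat.prime_dvd_prime_iff_eq hq (hA p hp)).mp hqp]

/-- A prime of `S` does not divide a `k` coprime to `Π_{p∈S} p`. [folklore] -/
theorem prime_not_dvd_of_coprime {k q : ℕ} (hq : q.Prime)
    (hcop : Nat.Coprime k (∏ p ∈ S, p)) (hqS : q ∈ S) : ¬ q ∣ k := by
  intro hqk
  have h1 : Nat.Coprime q (∏ p ∈ S, p) := Nat.Coprime.coprime_dvd_left hqk hcop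
  have h2 : q ∣ ∏ p ∈ S, p := Finset.dvd_prod_of_mem _ hqS
  have h3 : q = 1 := by
    have h4 := h1.gcd_eq_one
    rwa [Nat.gcd_eq_left h2] at h4
  exact hq.one_lt.ne' h3

/-- The `A`-slice vanishes off the multiples of `n_A = Π_{p∈A} p`. [folklore] -/
theorem slice_of_not_dvd {A : Finset ℕ} (hA : A ⊆ S) (hSp : ∀ p ∈ S, p.Prime) {n : ℕ}
    (h : ¬ (∏ p ∈ A, p) ∣ n) : slice c S a φ A n = 0 := by
  rw [slice, if_neg]
  rintro ⟨hfil, -, -⟩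
  apply h
  refine Finset.prod_primes_dvd n (fun p hp => (hSp p (hA hp)).prime) fun p hp => ?_
  have hpf : p ∈ S.filter (· ∣ n) := by rw [hfil]; exact hp
  exact (Finset.mem_filter.mp hpf).2

/-- The `A`-slice at `n = n_A·k`: it is the `ρ_S(n_A)`-summand at `k` times the design weight `w_A`
(nonzero only for `k ≥ 1` coprime to `Π_{p∈S} p`). [folklore] -/
theorem slice_prod_mul {A : Finset ℕ} (hA : A ⊆ S) (hSp : ∀ p ∈ S, p.Prime) (k : ℕ) :
    slice c S a φ A ((∏ p ∈ A, p) * k)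
      = (if 1 ≤ k ∧ Nat.Coprime k (∏ p ∈ S, p)
          then dwt c ((∏ p ∈ A, p) * k) / (((∏ p ∈ A, p) * k : ℕ) : ℝ) else 0) * designWeight a φ A := by
  have hAp : ∀ p ∈ A, p.Prime := fun p hp => hSp p (hA hp)
  by_cases hcond : 1 ≤ k ∧ Nat.Coprime k (∏ p ∈ S, p)
  · obtain ⟨hk1, hcop⟩ := hcond
    rw [if_pos ⟨hk1, hcop⟩, slice, if_pos]
    refine ⟨?_, ?_, ?_⟩
    · -- S.filter (· ∣ (∏ p ∈ A, p) * k) = A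
      ext q
      simp only [Finset.mem_filter]
      constructor
      · rintro ⟨hqS, hqdvd⟩
        have hq : q.Prime := hSp q hqS
        rcases (Nat.Prime.dvd_mul hq).mp hqdvd with hqA | hqk
        · exact mem_of_prime_dvd_prod_primes hAp hq hqA
        · exact absurd hqk (prime_not_dvd_of_coprime hq hcop hqS)
      · intro hqA
        exact ⟨hA hqA, dvd_mul_of_dvd_left (Finset.dvd_prod_of_mem _ hqA) k⟩
    · -- squarefreeness at S
      intro p hpS hsq
      have hp : p.Prime := hSp p hpS
      have hpk : ¬ p ∣ k := prime_not_dvd_of_coprime hp hcop hpS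
      by_cases hpA : p ∈ A
      · -- write (∏ p ∈ A, p) = p * m with p ∤ m
        have hm : ∏ p ∈ A, p = p * ∏ q ∈ A.erase p, q := by
          rw [← Finset.mul_prod_erase A _ hpA]
        have hpm : ¬ p ∣ (∏ q ∈ A.erase p, q) := by
          intro h
          exact Finset.notMem_erase p A
            (mem_of_prime_dvd_prod_primes (fun q hq => hAp q (Finset.mem_of_mem_erase hq)) hp h)
        have h1 : p * p ∣ p * ((∏ q ∈ A.erase p, q) * k) := by
          have : p ^ 2 ∣ p * ((∏ q ∈ A.erase p, q) * k) := by
            rw [← mul_assoc, ← hm]; exact hsq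
          rwa [pow_two] at this
        have h2 : p ∣ (∏ q ∈ A.erase p, q) * k :=
          (mul_dvd_mul_iff_left hp.pos.ne').mp h1
        rcases (Nat.Prime.dvd_mul hp).mp h2 with h3 | h3
        · exact hpm h3
        · exact hpk h3
      · have hpn : ¬ p ∣ ∏ p ∈ A, p := fun h => hpA (mem_of_prime_dvd_prod_primes hAp hp h)
        have h1 : p ∣ (∏ p ∈ A, p) * k := dvd_trans (dvd_pow_self p two_ne_zero) hsq
        rcases (Nat.Prime.dvd_mul hp).mp h1 with h2 | h2
        · exact hpn h2
        · exact hpk h2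
    · -- 1 ≤ (∏ p ∈ A, p) * k
      exact Nat.one_le_iff_ne_zero.mpr
        (Nat.mul_ne_zero (Finset.prod_pos fun p hp => (hAp p hp).pos).ne' (by omega))
  · rw [if_neg hcond, zero_mul]
    rcases Nat.eq_zero_or_pos k with hk0 | hkpos
    · subst hk0
      rw [slice, if_neg]
      rintro ⟨-, -, h1⟩
      simp at h1
    · have hncop : ¬ Nat.Coprime k (∏ p ∈ S, p) := fun h => hcond ⟨hkpos, h⟩
      obtain ⟨q, hq, hqk, hqP⟩ := Nat.Prime.not_coprime_iff_dvd.mp hncop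
      have hqS : q ∈ S := by
        obtain ⟨p, hp, hqp⟩ := (Prime.dvd_finsetProd_iff hq.prime id).mp hqP
        rwa [(Nat.prime_dvd_prime_iff_eq hq (hSp p hp)).mp hqp]
      rw [slice, if_neg]
      rintro ⟨hfil, hsq, -⟩
      by_cases hqA : q ∈ A
      · refine hsq q hqS ?_
        rw [pow_two]
        exact mul_dvd_mul (Finset.dvd_prod_of_mem _ hqA) hqk
      · apply hqA
        rw [← hfil, Finset.mem_filter]
        exact ⟨hqS, dvd_mul_of_dvd_right hqk _⟩

/-- Each slice is absolutely summable under AX-A. [folklore] -/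
theorem summable_slice {A : Finset ℕ}
    (hd : Summable fun n : ℕ => |dwt c n| / (n : ℝ)) :
    Summable (slice c S a φ A) := by
  refine Summable.of_abs ?_
  refine Summable.of_nonneg_of_le (fun n => abs_nonneg _) (fun n => ?_)
    (hd.mul_right |designWeight a φ A|)
  rw [slice]
  split
  · rw [abs_mul, abs_div, Nat.abs_cast]
  · rw [abs_zero]
    positivity

/-- `Σ_n slice_A(n) = w_A · ρ_S(n_A)` (reindex `n = n_A·k`). [folklore] -/
theorem tsum_slice {A : Finset ℕ} (hA : A ⊆ S) (hSp : ∀ p ∈ S, p.Prime) :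
    ∑' n : ℕ, slice c S a φ A n = designWeight a φ A * rho c S ((∏ p ∈ A, p)) := by
  have hApos : 0 < ∏ p ∈ A, p := Finset.prod_pos fun p hp => (hSp p (hA hp)).pos
  have hinj : Function.Injective (fun k : ℕ => (∏ p ∈ A, p) * k) := fun k1 k2 h =>
    Nat.eq_of_mul_eq_mul_left hApos h
  have hsupp : Function.support (slice c S a φ A)
      ⊆ Set.range (fun k : ℕ => (∏ p ∈ A, p) * k) := by
    intro n hn
    by_contra hr
    apply hn
    apply slice_of_not_dvd hA hSp
    intro hdvd
    exact hr ⟨n / (∏ p ∈ A, p), Nat.mul_div_cancel' hdvd⟩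
  rw [← Function.Injective.tsum_eq hinj hsupp]
  rw [tsum_congr (fun k => slice_prod_mul hA hSp k), tsum_mul_right]
  exact mul_comm _ _

/-- Pointwise: the design summand `d(n)/n · Φ(n)` is the sum of its slices over `A ⊆ S`
(exactly one slice is live, `A = {p ∈ S : p ∣ n}`, when `n ≥ 1` is squarefree at `S`). [folklore] -/
theorem term_eq_sum_slice (n : ℕ) :
    dwt c n / (n : ℝ) * profile S a φ n = ∑ A ∈ S.powerset, slice c S a φ A n := by
  rcases Nat.eq_zero_or_pos n with hn0 | hnpos
  · subst hn0
    have hL : dwt c 0 / ((0 : ℕ) : ℝ) * profile S a φ 0 = 0 := by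
      rw [Nat.cast_zero, div_zero, zero_mul]
    rw [hL]
    symm
    refine Finset.sum_eq_zero fun A _ => ?_
    rw [slice, if_neg]
    rintro ⟨-, -, h1⟩
    simp at h1
  · by_cases hsq : ∀ p ∈ S, ¬ (p ^ 2 ∣ n)
    · have hmem : S.filter (· ∣ n) ∈ S.powerset :=
        Finset.mem_powerset.mpr (Finset.filter_subset _ _)
      have hsingle : ∑ A ∈ S.powerset, slice c S a φ A n
          = slice c S a φ (S.filter (· ∣ n)) n :=
        Finset.sum_eq_single_of_mem _ hmem fun A _ hne => by
          rw [slice, if_neg]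
          rintro ⟨hfil, -, -⟩
          exact hne hfil.symm
      rw [hsingle, slice, if_pos ⟨rfl, hsq, hnpos⟩, profile, if_pos hsq]
    · rw [profile, if_neg hsq, mul_zero]
      symm
      refine Finset.sum_eq_zero fun A _ => ?_
      rw [slice, if_neg]
      rintro ⟨-, hsq', -⟩
      exact hsq hsq'

/-- the regrouping (2001 W-MAG eq. (marginal)/(EtA), as used in the proof of Prop. 5.3):
the design series equals `Σ_{A ⊆ S} w_A · ρ_S(n_A)`. [folklore] -/
theorem tsum_design_eq_sum_rho (hSp : ∀ p ∈ S, p.Prime)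
    (hd : Summable fun n : ℕ => |dwt c n| / (n : ℝ)) :
    ∑' n : ℕ, dwt c n / (n : ℝ) * profile S a φ n
      = ∑ A ∈ S.powerset, designWeight a φ A * rho c S ((∏ p ∈ A, p)) := by
  have hslice : ∀ A ∈ S.powerset, HasSum (slice c S a φ A)
      (designWeight a φ A * rho c S ((∏ p ∈ A, p))) := by
    intro A hA
    have h1 := (summable_slice (A := A) (S := S) (a := a) (φ := φ) hd).hasSum

    rwa [tsum_slice (Finset.mem_powerset.mp hA) hSp] at h1
  have hsum := hasSum_sum hslice
  have heq : (fun n : ℕ => ∑ A ∈ S.powerset, slice c S a φ A n)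
      = fun n : ℕ => dwt c n / (n : ℝ) * profile S a φ n :=
    funext fun n => (term_eq_sum_slice n).symm
  rw [heq] at hsum
  exact hsum.tsum_eq

end Regroup

/-! ### The design inequality via Fejér: eq:beta1 (2001 W-MAG Prop. 5.3) -/

section Beta1

variable {M : ℝ} {c : ℕ → ℝ}

/-- `w_A · ρ_S(n_A) = u_A · cos(|A| φ)`. [folklore] -/
theorem designWeight_mul_rho (a : ℕ → ℝ) (φ : ℝ) (c : ℕ → ℝ) (S : Finset ℕ)
    (A : Finset ℕ) :
    designWeight a φ A * rho c S ((∏ p ∈ A, p)) = uCoeff c S a A * Real.cos (A.card * φ) := by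
  rw [designWeight, uCoeff]; ring

/-- `u_∅ = ρ_S(1)`. [folklore] -/
theorem uCoeff_empty (c : ℕ → ℝ) (S : Finset ℕ) (a : ℕ → ℝ) :
    uCoeff c S a ∅ = rho c S 1 := by
  simp [uCoeff]

/-- `u_{p} = √p · a_p · ρ_S(p) / 2`. [folklore] -/
theorem uCoeff_singleton (c : ℕ → ℝ) (S : Finset ℕ) (a : ℕ → ℝ) (p : ℕ) :
    uCoeff c S a {p} = Real.sqrt p * a p * (1/2) * rho c S p := by
  simp [uCoeff]

/-- eq:beta1 (2001 W-MAG Prop. 5.3): for a weight `c` with AX-A and AX-C at slack `M`, any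
finite nonempty set `S` of primes and any `a : S → [0,1]`,
`|Σ_{p∈S} a_p √p ρ_S(p)| ≤ 2M − 4 ρ_S(1)`. [folklore] -/
theorem abs_sum_sqrt_rho_le (hd : Summable fun n : ℕ => |dwt c n| / (n : ℝ))
    (hC : ∀ S : Finset ℕ, (∀ p ∈ S, p.Prime) → ∀ a : ℕ → ℝ,
      (∀ p ∈ S, 0 ≤ a p ∧ a p ≤ 1) → ∀ φ : ℝ,
      (∑' n : ℕ, dwt c n / (n : ℝ) * profile S a φ n) ≤ M / 2)
    {S : Finset ℕ} (hSp : ∀ p ∈ S, p.Prime) (hSne : S.Nonempty) {a : ℕ → ℝ}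
    (ha : ∀ p ∈ S, 0 ≤ a p ∧ a p ≤ 1) :
    |∑ p ∈ S, a p * Real.sqrt p * rho c S p| ≤ 2 * M - 4 * rho c S 1 := by
  set β : ℕ → ℝ := fun k =>
    (if k = 0 then M / 2 else 0) - ∑ A ∈ S.powersetCard k, uCoeff c S a A with hβ
  -- the cosine polynomial with coefficients β is everywhere nonnegative
  have hpos : ∀ φ : ℝ, 0 ≤ ∑ k ∈ Finset.range (S.card + 1), β k * Real.cos (k * φ) := by
    intro φ
    have hdesign := hC S hSp a ha φ
    rw [tsum_design_eq_sum_rho hSp hd] at hdesign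
    have hgroup : ∑ A ∈ S.powerset, designWeight a φ A * rho c S ((∏ p ∈ A, p))
        = ∑ k ∈ Finset.range (S.card + 1),
            (∑ A ∈ S.powersetCard k, uCoeff c S a A) * Real.cos (k * φ) := by
      rw [Finset.powerset_card_disjiUnion, Finset.sum_disjiUnion]
      refine Finset.sum_congr rfl fun k _ => ?_
      rw [Finset.sum_mul]
      refine Finset.sum_congr rfl fun A hA => ?_
      rw [designWeight_mul_rho, (Finset.mem_powersetCard.mp hA).2]
    have hexp : ∑ k ∈ Finset.range (S.card + 1), β k * Real.cos (k * φ)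
        = M / 2 - ∑ k ∈ Finset.range (S.card + 1),
            (∑ A ∈ S.powersetCard k, uCoeff c S a A) * Real.cos (k * φ) := by
      have h1 : ∀ k ∈ Finset.range (S.card + 1),
          β k * Real.cos (k * φ)
            = (if k = 0 then M / 2 * Real.cos (k * φ) else 0)
              - (∑ A ∈ S.powersetCard k, uCoeff c S a A) * Real.cos (k * φ) := by
        intro k _
        simp only [hβ]
        rw [sub_mul, ite_mul, zero_mul]
      rw [Finset.sum_congr rfl h1, Finset.sum_sub_distrib]
      congr 1
      rw [Finset.sum_ite_eq' (Finset.range (S.card + 1)) 0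
        (fun k => M / 2 * Real.cos (k * φ)), if_pos (Finset.mem_range.mpr (Nat.succ_pos _))]
      norm_num
    rw [hexp, ← hgroup]
    linarith
  -- Fejér
  have hfejer := fejer_abs_coeff_one_le_two_mul_coeff_zero
    (Finset.Nonempty.card_pos hSne) β hpos
  -- compute β 0 and β 1
  have hβ0 : β 0 = M / 2 - rho c S 1 := by
    simp only [hβ, if_true, Finset.powersetCard_zero, Finset.sum_singleton, uCoeff_empty]
  have hβ1 : β 1 = -((1/2) * ∑ p ∈ S, a p * Real.sqrt p * rho c S p) := by
    simp only [hβ, one_ne_zero, if_false, Finset.powersetCard_one, Finset.sum_map,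
      Function.Embedding.coeFn_mk]
    have h2 : ∀ p ∈ S, uCoeff c S a {p} = (1/2) * (a p * Real.sqrt p * rho c S p) := by
      intro p _
      rw [uCoeff_singleton]; ring
    rw [Finset.sum_congr rfl h2, ← Finset.mul_sum]
    ring
  rw [hβ0, hβ1] at hfejer
  rw [abs_neg, abs_mul, abs_of_nonneg (by norm_num : (0:ℝ) ≤ 1/2)] at hfejer
  linarith

end Beta1

end Design

/-! ### Registered sub-goal -/

/-- **Registered sub-goal `stub_deficitOfDesign_beta1`** (= `Design.abs_sum_sqrt_rho_le`, eq:beta1 of 2001 W-MAG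
Prop. 5.3): AX-A and AX-C at slack `M` give `|Σ_{p∈S} a_p √p ρ_S(p)| ≤ 2M − 4ρ_S(1)` for every finite nonempty
set `S` of primes and every `a : S → [0,1]`. [folklore] -/
theorem stub_deficitOfDesign_beta1 :
    ∀ (M : ℝ) (c : ℕ → ℝ), Summable (fun n : ℕ => |Design.dwt c n| / (n : ℝ)) →
      (∀ S : Finset ℕ, (∀ p ∈ S, p.Prime) → ∀ a : ℕ → ℝ, (∀ p ∈ S, 0 ≤ a p ∧ a p ≤ 1) → ∀ φ : ℝ,
        (∑' n : ℕ, Design.dwt c n / (n : ℝ) * Design.profile S a φ n) ≤ M / 2) →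
      ∀ S : Finset ℕ, (∀ p ∈ S, p.Prime) → S.Nonempty → ∀ a : ℕ → ℝ, (∀ p ∈ S, 0 ≤ a p ∧ a p ≤ 1) →
        |∑ p ∈ S, a p * Real.sqrt p * Design.rho c S p| ≤ 2 * M - 4 * Design.rho c S 1 :=
  fun _ _ hd hC _ hSp hSne _ ha => Design.abs_sum_sqrt_rho_le hd hC hSp hSne ha

end Summit.RiemannHypothesis.RiemannHypothesis.Theorems.SignConeConeMagnification

end
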